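import Literature.MathematicalPhysics.QuantumFieldTheory.Balaban1983to89.Node00.OpsYSectELetters
import Literature.MathematicalPhysics.QuantumFieldTheory.Balaban1983to89.B9Thm315WholeSectERepOn

/-!
# `Balaban1983to89.Node00.OpsYRecordV5` — T. Bałaban, *Propagators for lattice gauge theories in a background field*, Commun. Math. Phys. **99** (1985)
# 389–434 [Balaban1985BackgroundPropagators], (3.9) p. 391, Sect. E (3.168)–(3.169) p. 430, Thm 3.15 (3.185)–(3.187) p. 432: THE RIGHT LETTERS `μ*`, `D̄*`
# OF (3.185) AS THE FORMAL TRANSPOSES OF `μ` (3.169), `D̄` (3.168); THE v5 INSTANCE OF RECORD OF NODE 00's OPERATOR LAYER WITH ALL FOUR Sect. E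
# LETTERS GENUINE; ROW 24 (`t315`) OF THE N06 CERTIFICATE WITH THE `LocalOuterY` CONJUNCT DISCHARGED

Print, (3.185) p. 432: *«C^{(k)}(Λ; U) = P_Λ(I + D̄μ)P_Λ C̃^{(k)}(U) P_Λ(I + μ*D̄*)P_Λ + P_Λ G̃₂(U) P_Λ»*, the adjoints `*` being those of the inner
products of p. 391 ((3.9): *«D^{η*}_{U₀}»*, the adjoint of the covariant derivative, `R(U)X = UXU⁻¹` p. 390).  `Node00.OpsYSectELetters` made `μ`, `D̄`
genuine functions of the background over the averaged-field parameter `V = 𝔳 U` and left `μ*`, `D̄*` parameters (its margin (ii)).  THIS FILE closes that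
margin: the transposes are CONSTRUCTED by transposing the transported kernels of the tree's (3.169) calculus (`B9Eq3169Mu`: `hol`, `trSum`, `cod`,
`AxialFrame.mu`) with the ADJOINT bond transports `R(V(b))* = R(V(b)⁻¹)`, and they are PROVED to be the transposes for every trace form (the tree's
(3.9) adjoint convention `B9Eq39Adjoint.trace_R_mul`: `τ(R(U)X·Y) = τ(X·R(U⁻¹)Y)` for a tracial `τ` — no star structure and no unitarity needed).

WHAT IS BUILT.
§1 `TransposeCalculus` (abstract frame `A : AxialFrame X Bond`, real-linear bond automorphisms `S(b)` = the adjoint transports): `trSumT S Γ v` — the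
   transpose of `B ↦ (R_y(V)B)(Γ)` as a bond function of the test value `v` (`δ_{b₁} ⊗ v + trSumT S Γ' (S(b₁)v)`); `codT S src tgt A y =
   Σ_{b₊ = y} S(b)A(b) − Σ_{b₋ = y} A(b)` — the transpose of `cod` (3.168); `pullT`, `muT S A λ q = Σ_y [Σ_{y′ ∈ B(y)} w(y′)·trSumT S Γ_{y′} (ν_y) −
   trSumT S Γ_y (ν_y)](q)`, `ν_y = hol(S⁻¹)(Γ_y)λ(y)` — the transpose of `AxialFrame.mu` (3.169).  ADJOINTNESS over any real-bilinear pairing `P` with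
   `P (R(b)u) v = P u (S(b)v)`: `pair_hol_symm_apply`, `pair_trSum`, ★ `pair_cod` (`Σ_b P((D̄μ)(b), A(b)) = Σ_y P(μ(y), (D̄ᵀA)(y))`), ★ `pair_mu`
   (`Σ_y P(μ(B)(y), λ(y)) = Σ_q P(B(q), (μᵀλ)(q))`).
§1b `TransposeBounds`: `muT_sgl`, SUPPORT `muT_sgl_eq_zero` (`μᵀ(δ_y ⊗ a)(q) = 0` unless `q ∈ Ax(y)`), KERNEL BOUND `norm_muT_sgl_le`
   (`‖μᵀ(δ_y ⊗ a)(q)‖ ≤ N_y(q)‖a‖` — the SAME axial occurrence weight `axOccY` as `μ`, for contracting `S`, `S⁻¹`); `codT_sgl`, `codT_sgl_eq_zero`,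
   `norm_codT_sgl_le`.
§2 `CLinearT`: `ℂ`-linearity for adjoint transports commuting with complex scalars; the maps `codTCLin`, `muTCLin`.
§3 `LettersT` (NODE 00 carriers at a member `x`, parameter `𝔳 : AvY 𝔸 x`): `RVTY x 𝔳 U q := (RVY x 𝔳 U q)⁻¹ = R(V(b)⁻¹)`; ★ `muTY x 𝔳 U :=
   muTCLin (RVTY) (axialFrameY x) ∘ₗ readK x : (SiteY → 𝔸) →ₗ[ℂ] (IBondY → 𝔸)` — THE LETTER `μ*`; ★ `DbarTY x 𝔳 U := placeK x ∘ₗ codTCLin (RVTY) b₋ b₊`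
   — THE LETTER `D̄*` (`DbarTY_apply_repY'`: `(D̄*A)(y) = Σ_{b₊ = y} V(b)⁻¹A(b)V(b) − Σ_{b₋ = y} A(b)`; `U = 1`: the plain divergence,
   `DbarTY_one_apply_repY`); ★★ `sectELettersYOfRecordT x 𝔳 𝔢₀ := { 𝔢₀ with mu := muY x 𝔳, Dbar := DbarY x 𝔳, muT := muTY x 𝔳, DbarT := DbarTY x 𝔳 }`
   — the Sect. E letter record with ALL FOUR letters of (3.185) genuine (`Λ̃`, `C`, `C*`, `⟨D̃⁽²⁾, J⟩`, `G̃₂` stay `𝔢₀`'s); `sectELettersYOfRecordT_eq`: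
   it IS `sectELettersYOfRecord x 𝔳 {𝔢₀ with muT, DbarT}`, so every face of `Node00.OpsYSectELetters` applies.
§4 `Adjoint`: `trFormY τ` (the trace form `(u, v) ↦ τ(uv)` as a real-bilinear pairing), `trFormY_RVY` (`R(V)* = R(V⁻¹)`), ★★ `sum_tr_muY_mul`:
   `Σ_z τ(μ(B)(z)·f(z)) = Σ_q τ(B(q)·(μ*f)(q))` and ★★ `sum_tr_DbarY_mul`: `Σ_q τ((D̄f)(q)·A(q)) = Σ_z τ(f(z)·(D̄*A)(z))` for EVERY tracial
   `τ : 𝔸 →ₗ[ℂ] ℂ`, every background `U` and every units-valued `𝔳` — `μ*`, `D̄*` ARE the transposes of `μ`, `D̄`.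
§5 `FacesT`: supports and kernel bounds of `μ*`, `D̄*` in the column form `localOuterY_of_letters` wants (weights `muWtY`, `DbarWtY` of
   `Node00.OpsYSectELetters`): `colMass₂_muTY_le` (`m_{μ*} = 2(d+1)ℓ`), `colMass₂_DbarTY_le` (`m_{D*} = 2`), `range₂_muTY_le` (`r_{μ*} = ℓ + 1`),
   `range₂_DbarTY_le` (`r_{D*} = 1`); ★★★ `localOuterY_ofRecordT (hG1) (𝔢₀) (h𝔳) : LocalOuterY x (sectELettersYOfRecordT x 𝔳 𝔢₀) (ℓ + 2) (1 + 4(d+1)ℓ)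
   (1 + 4(d+1)ℓ) U` — n06-m's locality schema of BOTH outer factors of (3.185) with NO letter-level hypothesis left (norm-one `G`, `G`-valued `V`).
§6 `RecordV5` (record fibre `M_N(ℂ)`, L²-operator norm): `norm_coe_le_one_of_le_unitaryUnits` (`hG1` for `G ≤ U(N)`: `‖g‖ = 1` by the C⋆-identity),
   `norm_coe_le_one_specialUnitaryUnits`; `sum_trace_muY_mul` ∕ `sum_trace_DbarY_mul` (§4 at `τ = Tr`); ★★ `sectEYOfRecordV5 N θ M⋆ 𝔢₀ x :=
   sectELettersYOfRecordT x (avYOfRecord x) (𝔢₀ x)` — the v5 Sect. E letters of a family; ★★★ `opsYOfRecordV5E 𝔯 𝔢₀ 𝔴 𝔈 := opsYOfRecordV4E … 𝔯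
   (sectEYOfRecordV5 … 𝔢₀) 𝔴 𝔈` — THE v5 INSTANCE OF RECORD (every `opsYOfRecordV4E_…` face applies verbatim, `opsYOfRecordV5E_eq`); ★★
   `localOuterY_sectEYOfRecordV5 (hG : G ≤ U(N)) (hU : U G-valued)` — NO residual hypothesis; ★★★ `t315_opsYOfRecordV5E_of_3185` ∕ `_on` — row 24 of the
   N06 certificate at the v5 instance through the (3.185) slot with the displayed schema REDUCED TO THREE conjuncts `givenBy3185Y ∧ hasRWExpCY ∧
   DecayMidY` (resp. `DecayMidOnY`): the `LocalOuterY` conjunct of `B9Thm315WholeSectERep(On)` is DISCHARGED in kernel (`G = SU(N) ≤ U(N)`, `U`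
   `G`-valued by the (3.35) clause of `Reg335`).

HONEST MARGINS. (i) `μ*`, `D̄*` are the transposes for the FLAT trace pairings `Σ_z τ(F(z)G(z))`, `Σ_q τ(B(q)A(q))` on NODE 00's carriers — the
lineage's convention (v) of `Node00.OpsYSectELetters` (flat adjoints, as `OpsYDeltaA.QsY`); print's `*` is the adjoint for the inner products (3.16)
with measure factors `η^{D}`, `(L^jη)^{D}`, which differ from the flat ones by the diagonal level weights recorded there; on `𝔤 = su(N)`-valued functions
the trace form `−Tr XY = Tr X*Y` is print's real inner product, so at the record fibre the transposes here are print's `μ*`, `D̄*` up to that diagonal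
convention.  (ii) `μ`'s kernel is supported on the placed unit sites (block centres); `μ*` reads its argument there (`readK`) — the transpose of the
placing `placeK`; both are exact transposes of each other (`sum_eq_sum_repY`).  (iii) The constants `r = ℓ + 2`, `m_E = m_F = 1 + 4(d+1)ℓ` depend on
`d, L` only, cruder than print's `O(1)`.  (iv) Nothing of (3.170)–(3.184) (the bounds on `μ`, the random-walk expansion of `C̃^{(k)}`) is claimed; the
(3.185) identity, the expansion slot and the middle-factor decay stay displayed in row 24.  Net new unproved facts: 0.
-/

noncomputable section

namespace Literature.MathematicalPhysics.QuantumFieldTheory.Balaban1983to89.Node00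

open B9Eq3169Mu
open B9Eq39Adjoint (R R_inv_R R_R_inv R_one R_smul trace_R_mul)
open B9Thm315WholeSectERep (LocalOuterY)
open B9Thm315WholeBlocksRect (blockCLM₂ blockCLM₂_apply)
open B9Thm314GpFlatTorusGeometry (tdistK)
open B9Thm314QGGQInvFlatTransfer (tdistK_triangle tdistK_comm)
open B9PinGeometryKLevelV1 (kLab)
open B9PinMembersKLevelV1 (MemberY)

variable {d ℓ : ℕ} {hd : 1 ≤ d + 1} {hL : Odd (ℓ + 1) ∧ 1 < ℓ + 1} {b₀ b₁ : ℝ} {Mstar : ℕ}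

/-! ## §1 The formal transposes of the (3.169) calculus over an abstract frame -/

section TransposeCalculus

variable {X Bond 𝔤 : Type} [NormedAddCommGroup 𝔤]

/-- `δ_q ⊗ ·` is additive. [cite: Balaban1985BackgroundPropagators, (3.187) p.432, bookkeeping] -/
theorem sglY_add [DecidableEq Bond] (q : Bond) (a a' : 𝔤) : sglY q (a + a') = sglY q a + sglY q a' := by
  funext b; simp only [sglY_apply, Pi.add_apply]; split <;> simp

/-- `δ_q ⊗ ·` is homogeneous. [cite: Balaban1985BackgroundPropagators, (3.187) p.432, bookkeeping] -/
theorem sglY_smul [DecidableEq Bond] {𝕜 : Type} [SMulZeroClass 𝕜 𝔤] (q : Bond) (c : 𝕜) (a : 𝔤) : sglY q (c • a) = c • sglY q a := by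
  funext b; simp only [sglY_apply, Pi.smul_apply]; split <;> simp

/-- `δ_q ⊗ 0 = 0`. [cite: Balaban1985BackgroundPropagators, (3.187) p.432, bookkeeping] -/
theorem sglY_zero [DecidableEq Bond] (q : Bond) : sglY q (0 : 𝔤) = 0 := by
  funext b; simp only [sglY_apply, Pi.zero_apply]; split <;> rfl

variable [NormedSpace ℝ 𝔤]

/-- transpose of transported sum: bond function of the test value at the initial point. [cite: Balaban1985BackgroundPropagators, (3.169) p.430, (3.185) p.432] -/
def trSumT [DecidableEq Bond] (S : Bond → 𝔤 ≃ₗ[ℝ] 𝔤) : List Bond → 𝔤 → Bond → 𝔤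
  | [], _ => 0
  | b :: Γ, v => sglY b v + trSumT S Γ (S b v)

/-- the transpose of the empty transported sum is `0`. [cite: Balaban1985BackgroundPropagators, (3.169) p.430, bookkeeping] -/
@[simp] theorem trSumT_nil [DecidableEq Bond] (S : Bond → 𝔤 ≃ₗ[ℝ] 𝔤) (v : 𝔤) : trSumT S [] v = 0 := rfl

/-- `(trSumT S (bΓ) v) = δ_b ⊗ v + trSumT S Γ (S(b)v)`. [cite: Balaban1985BackgroundPropagators, (3.169) p.430, bookkeeping] -/
@[simp] theorem trSumT_cons [DecidableEq Bond] (S : Bond → 𝔤 ≃ₗ[ℝ] 𝔤) (b : Bond) (Γ : List Bond) (v : 𝔤) :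
    trSumT S (b :: Γ) v = sglY b v + trSumT S Γ (S b v) := rfl

variable (S : Bond → 𝔤 ≃ₗ[ℝ] 𝔤)

/-- `trSumT` is additive in the test value. [cite: Balaban1985BackgroundPropagators, (3.169) p.430, bookkeeping] -/
theorem trSumT_add [DecidableEq Bond] : ∀ (Γ : List Bond) (v v' : 𝔤), trSumT S Γ (v + v') = trSumT S Γ v + trSumT S Γ v'
  | [], _, _ => by simp
  | b :: Γ, v, v' => by rw [trSumT_cons, trSumT_cons, trSumT_cons, map_add, trSumT_add Γ, sglY_add]; abel

/-- `trSumT` is real-homogeneous in the test value. [cite: Balaban1985BackgroundPropagators, (3.169) p.430, bookkeeping] -/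
theorem trSumT_smul [DecidableEq Bond] (c : ℝ) : ∀ (Γ : List Bond) (v : 𝔤), trSumT S Γ (c • v) = c • trSumT S Γ v
  | [], _ => by simp
  | b :: Γ, v => by rw [trSumT_cons, trSumT_cons, map_smul, trSumT_smul c Γ, sglY_smul, smul_add]

/-- `trSumT S Γ 0 = 0`. [cite: Balaban1985BackgroundPropagators, (3.169) p.430, bookkeeping] -/
theorem trSumT_zero [DecidableEq Bond] : ∀ Γ : List Bond, trSumT S Γ (0 : 𝔤) = 0
  | [] => rfl
  | b :: Γ => by rw [trSumT_cons, map_zero, trSumT_zero Γ, sglY_zero, add_zero]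

/-- support: the transpose of a transported sum lives on the bonds of the chain. [cite: Balaban1985BackgroundPropagators, (3.169) p.430, bookkeeping] -/
theorem trSumT_eq_zero_of_not_mem [DecidableEq Bond] {q : Bond} : ∀ {Γ : List Bond}, q ∉ Γ → ∀ v : 𝔤, trSumT S Γ v q = 0
  | [], _, _ => rfl
  | b :: Γ, h, v => by
      rw [List.mem_cons, not_or] at h
      rw [trSumT_cons, Pi.add_apply, sglY_apply, if_neg h.1, trSumT_eq_zero_of_not_mem h.2, add_zero]

/-- norm bound by occurrences for contracting adjoint transports. [cite: Balaban1985BackgroundPropagators, (3.169) p.430, (3.185) p.432] -/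
theorem norm_trSumT_le [DecidableEq Bond] (hS : ∀ b v, ‖S b v‖ ≤ ‖v‖) (q : Bond) :
    ∀ (Γ : List Bond) (v : 𝔤), ‖trSumT S Γ v q‖ ≤ occY q Γ * ‖v‖
  | [], v => by simp [occY]
  | b :: Γ, v => by
      rw [trSumT_cons, Pi.add_apply, occY, add_mul]
      refine (norm_add_le _ _).trans (add_le_add ?_ ((norm_trSumT_le hS q Γ _).trans
        (mul_le_mul_of_nonneg_left (hS b v) (occY_nonneg q Γ))))
      rw [sglY_apply]
      by_cases h : b = q
      · rw [if_pos h, if_pos h.symm, one_mul]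
      · rw [if_neg h, if_neg (fun e => h e.symm), norm_zero, zero_mul]

/-- forward transports along a chain contract when each bond transport does. [cite: Balaban1985BackgroundPropagators, p.390, bookkeeping] -/
theorem norm_hol_le (T : Bond → 𝔤 ≃ₗ[ℝ] 𝔤) (hT : ∀ b v, ‖T b v‖ ≤ ‖v‖) : ∀ (Γ : List Bond) (v : 𝔤), ‖hol T Γ v‖ ≤ ‖v‖
  | [], _ => le_rfl
  | b :: Γ, v => by rw [hol_cons_apply]; exact (hT b _).trans (norm_hol_le T hT Γ v)

/-- the inverse adjoint transports. [cite: Balaban1985BackgroundPropagators, (3.168) p.430, bookkeeping] -/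
abbrev symmFam (S : Bond → 𝔤 ≃ₗ[ℝ] 𝔤) : Bond → 𝔤 ≃ₗ[ℝ] 𝔤 := fun b => (S b).symm

/-- **THE FORMAL TRANSPOSE `D̄ᵀ` OF (3.168)**: `(D̄ᵀA)(y) = Σ_{b : b₊ = y} S(b) A(b) − Σ_{b : b₋ = y} A(b)`. [cite: Balaban1985BackgroundPropagators, (3.168) p.430, (3.185) p.432] -/
def codT [Fintype Bond] [DecidableEq X] (src tgt : Bond → X) (Al : Bond → 𝔤) (y : X) : 𝔤 :=
  (∑ b ∈ Finset.univ.filter (fun b => tgt b = y), S b (Al b)) - ∑ b ∈ Finset.univ.filter (fun b => src b = y), Al b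

/-- `codT` evaluated. [cite: Balaban1985BackgroundPropagators, (3.168) p.430, bookkeeping] -/
theorem codT_apply [Fintype Bond] [DecidableEq X] (src tgt : Bond → X) (Al : Bond → 𝔤) (y : X) : codT S src tgt Al y =
    (∑ b ∈ Finset.univ.filter (fun b => tgt b = y), S b (Al b)) - ∑ b ∈ Finset.univ.filter (fun b => src b = y), Al b := rfl

section Frame

variable [Fintype X] [DecidableEq X] (A : AxialFrame X Bond)

/-- the test value at `y` pulled to the base site along `Γ_y` by the inverse adjoint transports. [cite: Balaban1985BackgroundPropagators, (3.169) p.430, bookkeeping] -/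
def pullT (lam : X → 𝔤) (y : X) : 𝔤 := hol (symmFam S) (A.Γ y) (lam y)

/-- `pullT` evaluated. [cite: Balaban1985BackgroundPropagators, (3.169) p.430, bookkeeping] -/
@[simp] theorem pullT_apply (lam : X → 𝔤) (y : X) : pullT S A lam y = hol (symmFam S) (A.Γ y) (lam y) := rfl

/-- **THE FORMAL TRANSPOSE `μᵀ` OF (3.169)**. [cite: Balaban1985BackgroundPropagators, (3.169) p.430, (3.185) p.432] -/
def muT [DecidableEq Bond] (lam : X → 𝔤) (q : Bond) : 𝔤 :=
  ∑ y, ((∑ y' ∈ A.block y, A.w y' • trSumT S (A.Γ y') (pullT S A lam y) q) - trSumT S (A.Γ y) (pullT S A lam y) q)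

/-- `muT` evaluated. [cite: Balaban1985BackgroundPropagators, (3.169) p.430, bookkeeping] -/
theorem muT_apply [DecidableEq Bond] (lam : X → 𝔤) (q : Bond) : muT S A lam q =
    ∑ y, ((∑ y' ∈ A.block y, A.w y' • trSumT S (A.Γ y') (pullT S A lam y) q) - trSumT S (A.Γ y) (pullT S A lam y) q) := rfl

end Frame

/-! ### adjointness for a pairing with `⟪R(b)u, v⟫ = ⟪u, S(b)v⟫` -/

variable {M : Type} [AddCommGroup M] [Module ℝ M] (P : 𝔤 →ₗ[ℝ] 𝔤 →ₗ[ℝ] M) (R : Bond → 𝔤 ≃ₗ[ℝ] 𝔤)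
variable (hRS : ∀ (b : Bond) (u v : 𝔤), P (R b u) v = P u (S b v))
include hRS

/-- `⟪R(b)⁻¹u, v⟫ = ⟪u, S(b)⁻¹v⟫`. [cite: Balaban1985BackgroundPropagators, (3.9) p.391, bookkeeping] -/
theorem pair_symm_apply (b : Bond) (u v : 𝔤) : P ((R b).symm u) v = P u ((S b).symm v) := by
  have h := hRS b ((R b).symm u) ((S b).symm v)
  rw [LinearEquiv.apply_symm_apply, LinearEquiv.apply_symm_apply] at h
  exact h.symm

/-- `⟪R(V(Γ))⁻¹u, v⟫ = ⟪u, hol(S⁻¹)(Γ)v⟫`. [cite: Balaban1985BackgroundPropagators, (3.9) p.391, bookkeeping] -/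
theorem pair_hol_symm_apply : ∀ (Γ : List Bond) (u v : 𝔤), P ((hol R Γ).symm u) v = P u (hol (symmFam S) Γ v)
  | [], _, _ => rfl
  | b :: Γ, u, v => by
      show P (((hol R Γ).trans (R b)).symm u) v = _
      rw [LinearEquiv.symm_trans_apply, pair_hol_symm_apply Γ, pair_symm_apply S P R hRS, hol_cons_apply]

/-- **`⟪(R_y(V)B)(Γ), v⟫ = Σ_q ⟪B(q), (trSumT S Γ v)(q)⟫`**. [cite: Balaban1985BackgroundPropagators, (3.9) p.391 + p.390 (R(U)X = UXU⁻¹), (3.185) p.432] -/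
theorem pair_trSum [Fintype Bond] [DecidableEq Bond] :
    ∀ (B : Bond → 𝔤) (Γ : List Bond) (v : 𝔤), P (trSum R B Γ) v = ∑ q, P (B q) (trSumT S Γ v q)
  | B, [], v => by simp
  | B, b :: Γ, v => by
      rw [trSum_cons, map_add, LinearMap.add_apply, hRS, pair_trSum B Γ]
      simp only [trSumT_cons, Pi.add_apply, map_add, Finset.sum_add_distrib, sglY_apply]
      congr 1
      rw [Finset.sum_eq_single b (fun _ _ hq => by rw [if_neg hq, map_zero]) (fun h => absurd (Finset.mem_univ b) h), if_pos rfl]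

/-- **`Σ_b ⟪(D̄μ)(b), A(b)⟫ = Σ_y ⟪μ(y), (D̄ᵀA)(y)⟫`**. [cite: Balaban1985BackgroundPropagators, (3.9) p.391 + p.390 (R(U)X = UXU⁻¹), (3.185) p.432] -/
theorem pair_cod [Fintype Bond] [Fintype X] [DecidableEq X] (src tgt : Bond → X) (μ : X → 𝔤) (Al : Bond → 𝔤) :
    ∑ b, P (cod R src tgt μ b) (Al b) = ∑ y, P (μ y) (codT S src tgt Al y) := by
  simp only [cod_apply, codT_apply, map_sub, LinearMap.sub_apply, map_sum, Finset.sum_sub_distrib, hRS]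
  congr 1
  · rw [← Finset.sum_fiberwise Finset.univ tgt fun b => P (μ (tgt b)) (S b (Al b))]
    refine Finset.sum_congr rfl fun y _ => Finset.sum_congr rfl fun b hb => ?_
    rw [(Finset.mem_filter.1 hb).2]
  · rw [← Finset.sum_fiberwise Finset.univ src fun b => P (μ (src b)) (Al b)]
    refine Finset.sum_congr rfl fun y _ => Finset.sum_congr rfl fun b hb => ?_
    rw [(Finset.mem_filter.1 hb).2]

/-- **`Σ_y ⟪μ(B)(y), λ(y)⟫ = Σ_q ⟪B(q), (μᵀλ)(q)⟫`**. [cite: Balaban1985BackgroundPropagators, (3.9) p.391 + p.390 (R(U)X = UXU⁻¹), (3.185) p.432] -/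
theorem pair_mu [Fintype Bond] [DecidableEq Bond] [Fintype X] [DecidableEq X] (A : AxialFrame X Bond) (B : Bond → 𝔤) (lam : X → 𝔤) :
    ∑ y, P (A.mu R B y) (lam y) = ∑ q, P (B q) (muT S A lam q) := by
  have h1 : ∀ y, P (A.mu R B y) (lam y) =
      ∑ q, P (B q) ((∑ y' ∈ A.block y, A.w y' • trSumT S (A.Γ y') (pullT S A lam y) q) - trSumT S (A.Γ y) (pullT S A lam y) q) := by
    intro y
    unfold AxialFrame.mu
    rw [pair_hol_symm_apply S P R hRS, map_sub, LinearMap.sub_apply, pullT_apply]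
    unfold AxialFrame.bavg
    rw [map_sum, LinearMap.sum_apply]
    simp only [map_smul, LinearMap.smul_apply, pair_trSum S P R hRS, Finset.smul_sum, map_sub, Finset.sum_sub_distrib, map_sum,
      Finset.sum_comm (s := A.block y)]
  simp only [h1, muT_apply, map_sum]
  exact Finset.sum_comm


end TransposeCalculus

/-! ## §1b Supports and kernel bounds of the transposes over a frame -/

section TransposeBounds

variable {X Bond 𝔤 : Type} [NormedAddCommGroup 𝔤] [NormedSpace ℝ 𝔤]
variable (S : Bond → 𝔤 ≃ₗ[ℝ] 𝔤) [Fintype X] [DecidableEq X] (A : AxialFrame X Bond) [DecidableEq Bond]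

/-- `μᵀ` of a site delta `δ_y ⊗ a`. [cite: Balaban1985BackgroundPropagators, (3.169) p.430, bookkeeping] -/
theorem muT_sgl (y : X) (a : 𝔤) (q : Bond) : muT S A (sglY y a) q =
    (∑ y' ∈ A.block y, A.w y' • trSumT S (A.Γ y') (hol (symmFam S) (A.Γ y) a) q) - trSumT S (A.Γ y) (hol (symmFam S) (A.Γ y) a) q := by
  rw [muT_apply, Finset.sum_eq_single y]
  · rw [pullT_apply, sglY_apply, if_pos rfl]
  · intro y'' _ hne
    rw [pullT_apply, sglY_apply, if_neg hne, map_zero]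
    simp only [trSumT_zero, Pi.zero_apply, smul_zero, Finset.sum_const_zero, sub_zero]
  · intro h; exact absurd (Finset.mem_univ y) h

/-- **SUPPORT OF `μᵀ`**: `μᵀ(δ_y ⊗ a)(q) = 0` unless `q` is an axial bond of the block of `y`. [cite: Balaban1985BackgroundPropagators, (3.169) p.430, (3.185) p.432] -/
theorem muT_sgl_eq_zero {y : X} {q : Bond} (h : ¬ A.InAx y q) (a : 𝔤) : muT S A (sglY y a) q = 0 := by
  rw [muT_sgl]
  have h1 : ∀ y' ∈ A.block y, trSumT S (A.Γ y') (hol (symmFam S) (A.Γ y) a) q = 0 := fun y' hy' =>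
    trSumT_eq_zero_of_not_mem S (fun hq => h ⟨y', A.mem_block.1 hy', hq⟩) _
  have h2 : trSumT S (A.Γ y) (hol (symmFam S) (A.Γ y) a) q = 0 := trSumT_eq_zero_of_not_mem S (fun hq => h ⟨y, rfl, hq⟩) _
  rw [h2, sub_zero]
  exact Finset.sum_eq_zero fun y' hy' => by rw [h1 y' hy', smul_zero]

/-- **KERNEL BOUND OF `μᵀ`**: `‖μᵀ(δ_y ⊗ a)(q)‖ ≤ N_y(q)·‖a‖` — the SAME axial occurrence weight as `μ` (contracting `S`, `S⁻¹`). [cite: Balaban1985BackgroundPropagators, (3.169) p.430, (3.185) p.432] -/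
theorem norm_muT_sgl_le (hS : ∀ b v, ‖S b v‖ ≤ ‖v‖) (hS' : ∀ b v, ‖(S b).symm v‖ ≤ ‖v‖) (y : X) (a : 𝔤) (q : Bond) :
    ‖muT S A (sglY y a) q‖ ≤ axOccY A y q * ‖a‖ := by
  rw [muT_sgl]
  have hv : ‖hol (symmFam S) (A.Γ y) a‖ ≤ ‖a‖ := norm_hol_le (symmFam S) hS' _ _
  have h1 : ‖∑ y' ∈ A.block y, A.w y' • trSumT S (A.Γ y') (hol (symmFam S) (A.Γ y) a) q‖ ≤
      (∑ y' ∈ A.block y, A.w y' * occY q (A.Γ y')) * ‖a‖ := by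
    rw [Finset.sum_mul]
    refine (norm_sum_le _ _).trans (Finset.sum_le_sum fun y' _ => ?_)
    rw [norm_smul, Real.norm_of_nonneg (A.w_nonneg y'), mul_assoc]
    exact mul_le_mul_of_nonneg_left ((norm_trSumT_le S hS q _ _).trans (mul_le_mul_of_nonneg_left hv (occY_nonneg q _))) (A.w_nonneg y')
  have h2 : ‖trSumT S (A.Γ y) (hol (symmFam S) (A.Γ y) a) q‖ ≤ occY q (A.Γ y) * ‖a‖ :=
    (norm_trSumT_le S hS q _ _).trans (mul_le_mul_of_nonneg_left hv (occY_nonneg q _))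
  rw [axOccY, add_mul]
  exact (norm_sub_le _ _).trans (add_le_add h1 h2)

variable [Fintype Bond]

omit [Fintype X] [DecidableEq Bond] in
/-- `D̄ᵀ` of a bond delta `δ_p ⊗ a`. [cite: Balaban1985BackgroundPropagators, (3.168) p.430, bookkeeping] -/
theorem codT_sgl [DecidableEq Bond] (src tgt : Bond → X) (p : Bond) (a : 𝔤) (y : X) :
    codT S src tgt (sglY p a) y = (if tgt p = y then S p a else 0) - (if src p = y then a else 0) := by
  have h1 : ∀ b, S b (sglY p a b) = if b = p then S p a else 0 := by
    intro b; rw [sglY_apply]; split_ifs with h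
    · subst h; rfl
    · exact map_zero _
  have h2 : ∀ b, sglY p a b = if b = p then a else 0 := fun b => rfl
  simp_rw [codT_apply, h1, h2, Finset.sum_ite_eq', Finset.mem_filter, Finset.mem_univ, true_and]

omit [Fintype X] [DecidableEq Bond] in
/-- **SUPPORT OF `D̄ᵀ`**: `D̄ᵀ(δ_p ⊗ a)(y) = 0` unless `y = p₊` or `y = p₋`. [cite: Balaban1985BackgroundPropagators, (3.168) p.430, (3.185) p.432] -/
theorem codT_sgl_eq_zero [DecidableEq Bond] (src tgt : Bond → X) {p : Bond} {y : X} (ht : tgt p ≠ y) (hs : src p ≠ y) (a : 𝔤) :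
    codT S src tgt (sglY p a) y = 0 := by
  rw [codT_sgl, if_neg ht, if_neg hs, sub_zero]

omit [Fintype X] [DecidableEq Bond] in
/-- **KERNEL BOUND OF `D̄ᵀ`**: `‖D̄ᵀ(δ_p ⊗ a)(y)‖ ≤ (1_{y = p₊} + 1_{y = p₋})·‖a‖` (contracting `S`). [cite: Balaban1985BackgroundPropagators, (3.168) p.430, (3.185) p.432] -/
theorem norm_codT_sgl_le [DecidableEq Bond] (hS : ∀ b v, ‖S b v‖ ≤ ‖v‖) (src tgt : Bond → X) (p : Bond) (a : 𝔤) (y : X) :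
    ‖codT S src tgt (sglY p a) y‖ ≤ ((if tgt p = y then 1 else 0) + (if src p = y then 1 else 0)) * ‖a‖ := by
  rw [codT_sgl, add_mul]
  refine (norm_sub_le _ _).trans (add_le_add ?_ ?_)
  · split
    · rw [one_mul]; exact hS p a
    · rw [norm_zero, zero_mul]
  · split
    · rw [one_mul]
    · rw [norm_zero, zero_mul]

end TransposeBounds

/-! ## §2 `ℂ`-linearity of the transposes for adjoint transports commuting with complex scalars -/

section CLinearT

variable {X Bond 𝔤 : Type} [NormedAddCommGroup 𝔤] [NormedSpace ℂ 𝔤]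
variable (S : Bond → 𝔤 ≃ₗ[ℝ] 𝔤) (hC : ∀ (b : Bond) (c : ℂ) (v : 𝔤), S b (c • v) = c • S b v)
include hC

/-- `trSumT` is `ℂ`-homogeneous in the test value when the adjoint transports commute with complex scalars. [cite: Balaban1985BackgroundPropagators, (3.169) p.430, bookkeeping] -/
theorem trSumT_smulC [DecidableEq Bond] (c : ℂ) : ∀ (Γ : List Bond) (v : 𝔤), trSumT S Γ (c • v) = c • trSumT S Γ v
  | [], _ => by simp
  | b :: Γ, v => by rw [trSumT_cons, trSumT_cons, hC, trSumT_smulC c Γ, sglY_smul, smul_add]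

omit hC in
/-- the inverse adjoint transports commute with complex scalars. [cite: Balaban1985BackgroundPropagators, (3.169) p.430, bookkeeping] -/
theorem symm_smulC' (hC : ∀ (b : Bond) (c : ℂ) (v : 𝔤), S b (c • v) = c • S b v) (b : Bond) (c : ℂ) (v : 𝔤) :
    (S b).symm (c • v) = c • (S b).symm v := by
  apply (S b).injective
  rw [LinearEquiv.apply_symm_apply, hC, LinearEquiv.apply_symm_apply]

/-- the inverse adjoint transport along a chain is `ℂ`-homogeneous. [cite: Balaban1985BackgroundPropagators, (3.169) p.430, bookkeeping] -/
theorem hol_symmFam_smulC (c : ℂ) : ∀ (Γ : List Bond) (v : 𝔤), hol (symmFam S) Γ (c • v) = c • hol (symmFam S) Γ v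
  | [], _ => rfl
  | b :: Γ, v => by rw [hol_cons_apply, hol_cons_apply, hol_symmFam_smulC c Γ v]; exact symm_smulC' S hC b c _

/-- `D̄ᵀ` is `ℂ`-homogeneous. [cite: Balaban1985BackgroundPropagators, (3.168) p.430, bookkeeping] -/
theorem codT_smulC [Fintype Bond] [DecidableEq X] (src tgt : Bond → X) (c : ℂ) (Al : Bond → 𝔤) :
    codT S src tgt (c • Al) = c • codT S src tgt Al := by
  funext y; simp only [codT_apply, Pi.smul_apply, hC, Finset.smul_sum, smul_sub]

omit hC in
/-- `D̄ᵀ` is additive. [cite: Balaban1985BackgroundPropagators, (3.168) p.430, bookkeeping] -/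
theorem codT_add [Fintype Bond] [DecidableEq X] (src tgt : Bond → X) (A₁ A₂ : Bond → 𝔤) :
    codT S src tgt (A₁ + A₂) = codT S src tgt A₁ + codT S src tgt A₂ := by
  funext y; simp only [codT_apply, Pi.add_apply, map_add, Finset.sum_add_distrib]; abel

/-- **`D̄ᵀ` as a `ℂ`-linear map** (bond functions → site functions). [cite: Balaban1985BackgroundPropagators, (3.168) p.430, (3.185) p.432] -/
def codTCLin [Fintype Bond] [DecidableEq X] (src tgt : Bond → X) : (Bond → 𝔤) →ₗ[ℂ] (X → 𝔤) where
  toFun := codT S src tgt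
  map_add' := codT_add S src tgt
  map_smul' c Al := codT_smulC S hC src tgt c Al

/-- `codTCLin` evaluated. [cite: Balaban1985BackgroundPropagators, (3.168) p.430, bookkeeping] -/
@[simp] theorem codTCLin_apply [Fintype Bond] [DecidableEq X] (src tgt : Bond → X) (Al : Bond → 𝔤) :
    codTCLin S hC src tgt Al = codT S src tgt Al := rfl

variable [Fintype X] [DecidableEq X] (A : AxialFrame X Bond)

omit hC in
/-- `μᵀ` is additive. [cite: Balaban1985BackgroundPropagators, (3.169) p.430, bookkeeping] -/
theorem muT_add [DecidableEq Bond] (l₁ l₂ : X → 𝔤) : muT S A (l₁ + l₂) = muT S A l₁ + muT S A l₂ := by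
  funext q
  rw [Pi.add_apply, muT_apply, muT_apply, muT_apply, ← Finset.sum_add_distrib]
  refine Finset.sum_congr rfl fun y _ => ?_
  simp only [pullT_apply, Pi.add_apply, map_add, trSumT_add, smul_add, Finset.sum_add_distrib]
  abel

/-- `μᵀ` is `ℂ`-homogeneous. [cite: Balaban1985BackgroundPropagators, (3.169) p.430, bookkeeping] -/
theorem muT_smulC [DecidableEq Bond] (c : ℂ) (lam : X → 𝔤) : muT S A (c • lam) = c • muT S A lam := by
  funext q
  simp only [muT_apply, Pi.smul_apply, pullT_apply, hol_symmFam_smulC S hC, trSumT_smulC S hC, Finset.smul_sum, smul_sub,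
    smul_comm (A.w _) c]

/-- **`μᵀ` as a `ℂ`-linear map** (site functions → bond functions). [cite: Balaban1985BackgroundPropagators, (3.169) p.430, (3.185) p.432] -/
def muTCLin [DecidableEq Bond] : (X → 𝔤) →ₗ[ℂ] (Bond → 𝔤) where
  toFun := muT S A
  map_add' := muT_add S A
  map_smul' := muT_smulC S hC A

/-- `muTCLin` evaluated. [cite: Balaban1985BackgroundPropagators, (3.169) p.430, bookkeeping] -/
@[simp] theorem muTCLin_apply [DecidableEq Bond] (lam : X → 𝔤) : muTCLin S hC A lam = muT S A lam := rfl

end CLinearT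

/-! ## §3 The letters `μ* = μᵀ` and `D̄* = D̄ᵀ` on NODE 00's carriers; the record with all four Sect. E letters -/

section LettersT

variable {𝔸 : Type} [NormedRing 𝔸] [NormedAlgebra ℂ 𝔸] [CompleteSpace 𝔸]
variable (x : MemberY d ℓ hd hL b₀ b₁ Mstar) (𝔳 : AvY 𝔸 x)

/-- **THE ADJOINT BOND TRANSPORTS `R(V(b))* = R(V(b)⁻¹)`** (the adjoint of `X ↦ VXV⁻¹` for the trace form `τ(XY)`, and for `Re Tr X*Y` when `V` is unitary). [cite: Balaban1985BackgroundPropagators, p.390 + (3.9) p.391, (3.168) p.430] -/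
def RVTY (U : CfgY 𝔸 x.toKIdx) (q : IBondY x.toKIdx) : 𝔸 ≃ₗ[ℝ] 𝔸 := (RVY x 𝔳 U q).symm

/-- `R(V(b))* X = V(b)⁻¹XV(b)`. [cite: Balaban1985BackgroundPropagators, (3.168) p.430, bookkeeping] -/
@[simp] theorem RVTY_apply (U : CfgY 𝔸 x.toKIdx) (q : IBondY x.toKIdx) (v : 𝔸) : RVTY x 𝔳 U q v = R (𝔳 U (ubondOfIdx x q))⁻¹ v := rfl

/-- `(R(V(b))*)⁻¹ = R(V(b))`. [cite: Balaban1985BackgroundPropagators, (3.168) p.430, bookkeeping] -/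
@[simp] theorem RVTY_symm (U : CfgY 𝔸 x.toKIdx) (q : IBondY x.toKIdx) : (RVTY x 𝔳 U q).symm = RVY x 𝔳 U q := rfl

/-- the inverse adjoint transports of record are the forward transports `R(V(b))`. [cite: Balaban1985BackgroundPropagators, (3.168) p.430, bookkeeping] -/
theorem symmFam_RVTY (U : CfgY 𝔸 x.toKIdx) : symmFam (RVTY x 𝔳 U) = RVY x 𝔳 U := rfl

/-- the adjoint transports commute with complex scalars. [cite: Balaban1985BackgroundPropagators, (3.169) p.430, bookkeeping] -/
theorem RVTY_smulC (U : CfgY 𝔸 x.toKIdx) : ∀ (q : IBondY x.toKIdx) (c : ℂ) (v : 𝔸), RVTY x 𝔳 U q (c • v) = c • RVTY x 𝔳 U q v :=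
  fun _ c v => R_smul _ c v

/-- at `U = 1` the adjoint transports of record are the identity. [cite: Balaban1985BackgroundPropagators, Cor. 3.5 p.407 (U = 1), bookkeeping] -/
@[simp] theorem RVTY_avYOfRecord_one (q : IBondY x.toKIdx) (v : 𝔸) : RVTY x (avYOfRecord x) (fun _ _ => 1 : CfgY 𝔸 x.toKIdx) q v = v := by
  rw [RVTY_apply, avYOfRecord_one, inv_one, R_one]

/-- ★ **THE LETTER `μ* = μᵀ`**: site functions → bond functions, the formal transpose of `μ` of (3.169) (transported kernels transposed with the adjoint
transports `R(V)* = R(V⁻¹)`), read at the block centres. [cite: Balaban1985BackgroundPropagators, (3.169) p.430, (3.185) p.432] -/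
def muTY (U : CfgY 𝔸 x.toKIdx) : (SiteY x.toKIdx → 𝔸) →ₗ[ℂ] (IBondY x.toKIdx → 𝔸) :=
  muTCLin (RVTY x 𝔳 U) (RVTY_smulC x 𝔳 U) (axialFrameY x) ∘ₗ readK x

/-- ★ **THE LETTER `D̄* = D̄ᵀ`**: bond functions → site functions, `(D̄*A)(y) = Σ_{b₊ = y} R(V(b))⁻¹A(b) − Σ_{b₋ = y} A(b)`, placed at the block centres. [cite: Balaban1985BackgroundPropagators, (3.168) p.430, (3.185) p.432] -/
def DbarTY (U : CfgY 𝔸 x.toKIdx) : (IBondY x.toKIdx → 𝔸) →ₗ[ℂ] (SiteY x.toKIdx → 𝔸) :=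
  placeK x ∘ₗ codTCLin (RVTY x 𝔳 U) (RVTY_smulC x 𝔳 U) (axialFrameY x).src (axialFrameY x).tgt

variable {x 𝔳}

/-- `μ*f` is the frame's `μᵀ` of the restriction of `f` to the unit sites. [cite: Balaban1985BackgroundPropagators, (3.169) p.430, bookkeeping] -/
theorem muTY_apply (U : CfgY 𝔸 x.toKIdx) (f : SiteY x.toKIdx → 𝔸) : muTY x 𝔳 U f = muT (RVTY x 𝔳 U) (axialFrameY x) (readK x f) := rfl

/-- `D̄*A` at a placed unit site is the frame's `D̄ᵀA`. [cite: Balaban1985BackgroundPropagators, (3.168) p.430, bookkeeping] -/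
@[simp] theorem DbarTY_apply_repY (U : CfgY 𝔸 x.toKIdx) (Al : IBondY x.toKIdx → 𝔸) (y : USiteY x) :
    DbarTY x 𝔳 U Al (repY x y) = codT (RVTY x 𝔳 U) (usrc x) (utgt x) Al y := by
  simp [DbarTY]
  rfl

/-- `D̄*A` vanishes off the placed unit sites. [cite: Balaban1985BackgroundPropagators, (3.168) p.430, bookkeeping] -/
theorem DbarTY_apply_of_not_range (U : CfgY 𝔸 x.toKIdx) (Al : IBondY x.toKIdx → 𝔸) {z : SiteY x.toKIdx} (h : ¬ ∃ y, repY x y = z) :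
    DbarTY x 𝔳 U Al z = 0 := by
  simp only [DbarTY, LinearMap.coe_comp, Function.comp_apply]
  exact placeK_of_not_range x _ h

/-- the restriction of `D̄*A` to the unit sites is the frame's `D̄ᵀA`. [cite: Balaban1985BackgroundPropagators, (3.168) p.430, bookkeeping] -/
@[simp] theorem readK_DbarTY (U : CfgY 𝔸 x.toKIdx) (Al : IBondY x.toKIdx → 𝔸) :
    readK x (DbarTY x 𝔳 U Al) = codT (RVTY x 𝔳 U) (usrc x) (utgt x) Al := by
  funext y; rw [readK_apply, DbarTY_apply_repY]

/-- **`D̄*` EVALUATED** at a unit site. [cite: Balaban1985BackgroundPropagators, (3.168) p.430, (3.185) p.432] -/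
theorem DbarTY_apply_repY' (U : CfgY 𝔸 x.toKIdx) (Al : IBondY x.toKIdx → 𝔸) (y : USiteY x) :
    DbarTY x 𝔳 U Al (repY x y) = (∑ p ∈ Finset.univ.filter (fun p => utgt x p = y), R (𝔳 U (ubondOfIdx x p))⁻¹ (Al p)) -
      ∑ p ∈ Finset.univ.filter (fun p => usrc x p = y), Al p := by
  rw [DbarTY_apply_repY, codT_apply]
  rfl

open Classical in
omit [CompleteSpace 𝔸] in
/-- a site delta at a placed unit site restricts to the unit-site delta. [cite: Balaban1985BackgroundPropagators, (3.187) p.432, bookkeeping] -/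
theorem readK_deltaY_repY (y : USiteY x) (a : 𝔸) : readK x (deltaY (repY x y) a) = sglY y a := by
  funext y'
  rw [readK_apply, sglY_apply]
  unfold deltaY
  by_cases h : y' = y
  · subst h; rw [if_pos rfl, if_pos rfl]
  · rw [if_neg (fun e => h (repY_injective x e)), if_neg h]

omit [CompleteSpace 𝔸] in
/-- a site delta off the placed unit sites restricts to `0`. [cite: Balaban1985BackgroundPropagators, (3.187) p.432, bookkeeping] -/
theorem readK_deltaY_of_not_range {s : SiteY x.toKIdx} (h : ¬ ∃ y, repY x y = s) (a : 𝔸) : readK x (deltaY s a) = 0 := by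
  funext y'
  rw [readK_apply, Pi.zero_apply]
  unfold deltaY
  rw [if_neg (fun e => h ⟨y', e⟩)]

/-- `U = 1`, record transports: `D̄*` is the plain divergence. [cite: Balaban1985BackgroundPropagators, Cor. 3.5 p.407 (U = 1), bookkeeping] -/
theorem DbarTY_one_apply_repY (Al : IBondY x.toKIdx → 𝔸) (y : USiteY x) :
    DbarTY x (avYOfRecord x) (fun _ _ => 1 : CfgY 𝔸 x.toKIdx) Al (repY x y) =
      (∑ p ∈ Finset.univ.filter (fun p => utgt x p = y), Al p) - ∑ p ∈ Finset.univ.filter (fun p => usrc x p = y), Al p := by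
  rw [DbarTY_apply_repY, codT_apply]
  simp only [RVTY_avYOfRecord_one]

variable (x 𝔳)

/-- ★★ **THE SECT. E LETTER RECORD WITH ALL FOUR LETTERS OF RECORD**: `𝔢₀` with `μ ∕ D̄ ∕ μ* ∕ D̄*` replaced by `muY ∕ DbarY ∕ muTY ∕ DbarTY` over `𝔳`
(`Λ̃`, `C ∕ C*`, `⟨D̃⁽²⁾, J⟩`, `G̃₂` stay `𝔢₀`'s). [cite: Balaban1985BackgroundPropagators, (3.168)–(3.169) p.430, (3.185)–(3.186) p.432] -/
def sectELettersYOfRecordT (𝔢₀ : SectELettersY 𝔸 x) : SectELettersY 𝔸 x :=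
  { 𝔢₀ with mu := muY x 𝔳, Dbar := DbarY x 𝔳, muT := muTY x 𝔳, DbarT := DbarTY x 𝔳 }

/-- the four-letter record IS §-FILE-10's record applied to `𝔢₀` with its right letters replaced (so every face of `sectELettersYOfRecord` applies). [cite: Balaban1985BackgroundPropagators, (3.185) p.432, bookkeeping] -/
theorem sectELettersYOfRecordT_eq (𝔢₀ : SectELettersY 𝔸 x) :
    sectELettersYOfRecordT x 𝔳 𝔢₀ = sectELettersYOfRecord x 𝔳 { 𝔢₀ with muT := muTY x 𝔳, DbarT := DbarTY x 𝔳 } := rfl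

variable {𝔳}

/-- CONTRACTION of the adjoint transports (norm-one `G`, `G`-valued `V`). [cite: Balaban1985BackgroundPropagators, p.390, bookkeeping] -/
theorem norm_RVTY_le {G : Subgroup 𝔸ˣ} (hG1 : ∀ g ∈ G, ‖((g : 𝔸ˣ) : 𝔸)‖ ≤ 1) {U : CfgY 𝔸 x.toKIdx} (h𝔳 : ∀ b, 𝔳 U b ∈ G) :
    ∀ (q : IBondY x.toKIdx) (v : 𝔸), ‖RVTY x 𝔳 U q v‖ ≤ ‖v‖ := norm_RVY_symm_le x hG1 h𝔳

/-- contraction of the inverse adjoint transports. [cite: Balaban1985BackgroundPropagators, p.390, bookkeeping] -/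
theorem norm_RVTY_symm_le {G : Subgroup 𝔸ˣ} (hG1 : ∀ g ∈ G, ‖((g : 𝔸ˣ) : 𝔸)‖ ≤ 1) {U : CfgY 𝔸 x.toKIdx} (h𝔳 : ∀ b, 𝔳 U b ∈ G) :
    ∀ (q : IBondY x.toKIdx) (v : 𝔸), ‖(RVTY x 𝔳 U q).symm v‖ ≤ ‖v‖ := norm_RVY_le x hG1 h𝔳

variable {x}

/-- the record's `μ` is `muY`. [cite: Balaban1985BackgroundPropagators, (3.169) p.430, bookkeeping] -/
@[simp] theorem sectELettersYOfRecordT_mu (𝔢₀ : SectELettersY 𝔸 x) : (sectELettersYOfRecordT x 𝔳 𝔢₀).mu = muY x 𝔳 := rfl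
/-- the record's `D̄` is `DbarY`. [cite: Balaban1985BackgroundPropagators, (3.168) p.430, bookkeeping] -/
@[simp] theorem sectELettersYOfRecordT_Dbar (𝔢₀ : SectELettersY 𝔸 x) : (sectELettersYOfRecordT x 𝔳 𝔢₀).Dbar = DbarY x 𝔳 := rfl
/-- the record's `μ*` is `muTY`. [cite: Balaban1985BackgroundPropagators, (3.185) p.432, bookkeeping] -/
@[simp] theorem sectELettersYOfRecordT_muT (𝔢₀ : SectELettersY 𝔸 x) : (sectELettersYOfRecordT x 𝔳 𝔢₀).muT = muTY x 𝔳 := rfl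
/-- the record's `D̄*` is `DbarTY`. [cite: Balaban1985BackgroundPropagators, (3.185) p.432, bookkeeping] -/
@[simp] theorem sectELettersYOfRecordT_DbarT (𝔢₀ : SectELettersY 𝔸 x) : (sectELettersYOfRecordT x 𝔳 𝔢₀).DbarT = DbarTY x 𝔳 := rfl
/-- the record keeps `Λ̃`. [cite: Balaban1985BackgroundPropagators, (3.157) p.428, bookkeeping] -/
@[simp] theorem sectELettersYOfRecordT_LamT (𝔢₀ : SectELettersY 𝔸 x) : (sectELettersYOfRecordT x 𝔳 𝔢₀).LamT = 𝔢₀.LamT := rfl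
/-- the record keeps `G̃₂`. [cite: Balaban1985BackgroundPropagators, (3.186) p.432, bookkeeping] -/
@[simp] theorem sectELettersYOfRecordT_Gt2 (𝔢₀ : SectELettersY 𝔸 x) : (sectELettersYOfRecordT x 𝔳 𝔢₀).Gt2 = 𝔢₀.Gt2 := rfl
/-- the record keeps `C`. [cite: Balaban1985BackgroundPropagators, (3.157) p.428, bookkeeping] -/
@[simp] theorem sectELettersYOfRecordT_elimC (𝔢₀ : SectELettersY 𝔸 x) : (sectELettersYOfRecordT x 𝔳 𝔢₀).elimC = 𝔢₀.elimC := rfl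
/-- the record keeps `C*`. [cite: Balaban1985BackgroundPropagators, (3.157) p.428, bookkeeping] -/
@[simp] theorem sectELettersYOfRecordT_elimCt (𝔢₀ : SectELettersY 𝔸 x) : (sectELettersYOfRecordT x 𝔳 𝔢₀).elimCt = 𝔢₀.elimCt := rfl
/-- the record keeps `⟨D̃⁽²⁾, J⟩`. [cite: Balaban1985BackgroundPropagators, (3.156) p.428, bookkeeping] -/
@[simp] theorem sectELettersYOfRecordT_D2J (𝔢₀ : SectELettersY 𝔸 x) : (sectELettersYOfRecordT x 𝔳 𝔢₀).D2J = 𝔢₀.D2J := rfl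

end LettersT

/-! ## §4 Adjointness: `μ*`, `D̄*` ARE the transposes of `μ`, `D̄` for every trace form `⟨F, G⟩ = Σ τ(F·G)` -/

section Adjoint

variable {𝔸 : Type} [NormedRing 𝔸] [NormedAlgebra ℂ 𝔸] [CompleteSpace 𝔸]
variable {x : MemberY d ℓ hd hL b₀ b₁ Mstar} {𝔳 : AvY 𝔸 x}

/-- the trace form `(u, v) ↦ τ(uv)` of a complex-linear functional on an abstract fibre algebra, as a real-bilinear complex-valued pairing (cf. the tree's
matrix trace forms `Beta.AveragedTransportVariance.trForm` (real matrices), `HaarDensityEvenClosedSubgroup.trForm`, `B11TracePairing.trPair` — all at `M_n`, real-valued;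
none over an abstract `𝔸` with a general tracial `τ`). [cite: Balaban1985BackgroundPropagators, (3.9) p.391, bookkeeping] -/
def trFormY (τ : 𝔸 →ₗ[ℂ] ℂ) : 𝔸 →ₗ[ℝ] 𝔸 →ₗ[ℝ] ℂ :=
  LinearMap.mk₂ ℝ (fun u v => τ (u * v))
    (fun u₁ u₂ v => by simp only [add_mul, map_add])
    (fun c u v => by rw [← Complex.coe_smul, smul_mul_assoc, map_smul, smul_eq_mul, Complex.real_smul])
    (fun u v₁ v₂ => by simp only [mul_add, map_add])
    (fun c u v => by rw [← Complex.coe_smul, mul_smul_comm, map_smul, smul_eq_mul, Complex.real_smul])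

omit [CompleteSpace 𝔸] in
/-- `trFormY τ u v = τ(uv)`. [cite: Balaban1985BackgroundPropagators, (3.9) p.391, bookkeeping] -/
@[simp] theorem trFormY_apply (τ : 𝔸 →ₗ[ℂ] ℂ) (u v : 𝔸) : trFormY τ u v = τ (u * v) := rfl

/-- **`R(V)* = R(V⁻¹)` FOR THE TRACE FORM**: `τ(R(V(b))u · v) = τ(u · R(V(b))⁻¹v)` for a tracial `τ`. [cite: Balaban1985BackgroundPropagators, (3.9) p.391 + p.390 (R(U)X = UXU⁻¹), (3.185) p.432] -/
theorem trFormY_RVY (τ : 𝔸 →ₗ[ℂ] ℂ) (hτ : ∀ a b : 𝔸, τ (a * b) = τ (b * a)) (U : CfgY 𝔸 x.toKIdx) :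
    ∀ (q : IBondY x.toKIdx) (u v : 𝔸), trFormY τ (RVY x 𝔳 U q u) v = trFormY τ u (RVTY x 𝔳 U q v) :=
  fun q u v => by rw [trFormY_apply, trFormY_apply, RVY_apply, RVTY_apply]; exact trace_R_mul τ hτ _ u v

omit [NormedAlgebra ℂ 𝔸] [CompleteSpace 𝔸] in
/-- sums over NODE 00's site carrier of functions vanishing off the placed unit sites. [cite: Balaban1985BackgroundPropagators, p.427, bookkeeping] -/
theorem sum_eq_sum_repY {M : Type} [AddCommMonoid M] (g : SiteY x.toKIdx → M) (hg : ∀ z, (¬ ∃ y, repY x y = z) → g z = 0) :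
    ∑ z, g z = ∑ y, g (repY x y) := by
  classical
  rw [← Finset.sum_image (f := g) (s := Finset.univ) (g := repY x) fun y _ y' _ h => repY_injective x h]
  refine (Finset.sum_subset (Finset.subset_univ _) fun z _ hz => hg z ?_).symm
  rintro ⟨y, rfl⟩
  exact hz (Finset.mem_image_of_mem _ (Finset.mem_univ y))

/-- ★★ **`μ* IS THE TRANSPOSE OF μ`**: `Σ_z τ(μ(B)(z)·f(z)) = Σ_q τ(B(q)·(μ*f)(q))` for every tracial `τ`, every units-valued `V`. [cite: Balaban1985BackgroundPropagators, (3.9) p.391 + p.390 (R(U)X = UXU⁻¹), (3.185) p.432] -/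
theorem sum_tr_muY_mul (τ : 𝔸 →ₗ[ℂ] ℂ) (hτ : ∀ a b : 𝔸, τ (a * b) = τ (b * a)) (U : CfgY 𝔸 x.toKIdx)
    (B : IBondY x.toKIdx → 𝔸) (f : SiteY x.toKIdx → 𝔸) :
    ∑ z, τ (muY x 𝔳 U B z * f z) = ∑ q, τ (B q * muTY x 𝔳 U f q) := by
  classical
  rw [sum_eq_sum_repY (fun z => τ (muY x 𝔳 U B z * f z)) fun z hz => by rw [muY_apply_of_not_range U B hz, zero_mul, map_zero]]
  simp only [muY_apply_repY, muTY_apply]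
  have h := pair_mu (RVTY x 𝔳 U) (trFormY τ) (RVY x 𝔳 U) (trFormY_RVY τ hτ U) (axialFrameY x) B (readK x f)
  simp only [trFormY_apply, readK_apply] at h
  exact h

/-- ★★ **`D̄* IS THE TRANSPOSE OF D̄`**: `Σ_q τ((D̄f)(q)·A(q)) = Σ_z τ(f(z)·(D̄*A)(z))`. [cite: Balaban1985BackgroundPropagators, (3.9) p.391 + p.390 (R(U)X = UXU⁻¹), (3.185) p.432] -/
theorem sum_tr_DbarY_mul (τ : 𝔸 →ₗ[ℂ] ℂ) (hτ : ∀ a b : 𝔸, τ (a * b) = τ (b * a)) (U : CfgY 𝔸 x.toKIdx)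
    (f : SiteY x.toKIdx → 𝔸) (Al : IBondY x.toKIdx → 𝔸) :
    ∑ q, τ (DbarY x 𝔳 U f q * Al q) = ∑ z, τ (f z * DbarTY x 𝔳 U Al z) := by
  classical
  rw [sum_eq_sum_repY (fun z => τ (f z * DbarTY x 𝔳 U Al z)) fun z hz => by rw [DbarTY_apply_of_not_range U Al hz, mul_zero, map_zero]]
  simp only [DbarTY_apply_repY]
  have h := pair_cod (RVTY x 𝔳 U) (trFormY τ) (RVY x 𝔳 U) (trFormY_RVY τ hτ U) (usrc x) (utgt x) (readK x f) Al
  simp only [trFormY_apply, readK_apply] at h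
  rw [← h]
  refine Finset.sum_congr rfl fun q _ => ?_
  rw [DbarY_apply, cod_apply]
  rfl

end Adjoint

/-! ## §5 Locality faces of `μ*`, `D̄*` and `LocalOuterY` at the four-letter record with NO residual hypotheses -/

section FacesT

variable {𝔸 : Type} [NormedRing 𝔸] [NormedAlgebra ℂ 𝔸] [CompleteSpace 𝔸]
variable {x : MemberY d ℓ hd hL b₀ b₁ Mstar} {𝔳 : AvY 𝔸 x}

/-- **SUPPORT OF `μ*`** (column form): `μ*(δ_s ⊗ a)(p)` vanishes unless `s` is a placed unit site `y` with `p` axial for the block of `y`. [cite: Balaban1985BackgroundPropagators, (3.169) p.430, bookkeeping] -/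
theorem muTY_deltaY_eq_zero_of_not_range (U : CfgY 𝔸 x.toKIdx) {s : SiteY x.toKIdx} (h : ¬ ∃ y, repY x y = s) (a : 𝔸) (p : IBondY x.toKIdx) :
    muTY x 𝔳 U (deltaY s a) p = 0 := by
  classical
  rw [muTY_apply, readK_deltaY_of_not_range h, show muT (RVTY x 𝔳 U) (axialFrameY x) 0 = 0 from map_zero (muTCLin (RVTY x 𝔳 U) (RVTY_smulC x 𝔳 U) (axialFrameY x))]
  rfl

/-- `μ*(δ_y ⊗ a)(p) = 0` at a placed unit site `y` unless `p` is axial for the block of `y`. [cite: Balaban1985BackgroundPropagators, (3.169) p.430, bookkeeping] -/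
theorem muTY_deltaY_repY_eq_zero (U : CfgY 𝔸 x.toKIdx) {y : USiteY x} {p : IBondY x.toKIdx} (h : ¬ (axialFrameY x).InAx y p) (a : 𝔸) :
    muTY x 𝔳 U (deltaY (repY x y) a) p = 0 := by
  classical
  rw [muTY_apply, readK_deltaY_repY]
  exact muT_sgl_eq_zero (RVTY x 𝔳 U) (axialFrameY x) h a

/-- **KERNEL BOUND OF `μ*`**: `‖μ*(δ_s ⊗ a)(p)‖ ≤ w^μ_{sp}‖a‖` — the same weights as `μ`. [cite: Balaban1985BackgroundPropagators, (3.169) p.430, (3.185) p.432] -/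
theorem norm_muTY_deltaY_le {G : Subgroup 𝔸ˣ} (hG1 : ∀ g ∈ G, ‖((g : 𝔸ˣ) : 𝔸)‖ ≤ 1) {U : CfgY 𝔸 x.toKIdx} (h𝔳 : ∀ b, 𝔳 U b ∈ G)
    (s : SiteY x.toKIdx) (p : IBondY x.toKIdx) (a : 𝔸) : ‖muTY x 𝔳 U (deltaY s a) p‖ ≤ muWtY x s p * ‖a‖ := by
  classical
  unfold muWtY
  by_cases h : ∃ y, repY x y = s
  · rw [dif_pos h]
    obtain ⟨y, rfl⟩ := id h
    have e : h.choose = y := repY_injective x h.choose_spec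
    rw [e, muTY_apply, readK_deltaY_repY]
    exact norm_muT_sgl_le (RVTY x 𝔳 U) (axialFrameY x) (norm_RVTY_le x hG1 h𝔳) (norm_RVTY_symm_le x hG1 h𝔳) y a p
  · rw [dif_neg h, muTY_deltaY_eq_zero_of_not_range U h, norm_zero, zero_mul]

/-- **SUPPORT OF `D̄*`**: `D̄*(δ_q ⊗ a)(s)` vanishes unless `s` is the placed `b₊` or `b₋` of `q`. [cite: Balaban1985BackgroundPropagators, (3.168) p.430, bookkeeping] -/
theorem DbarTY_deltaY_eq_zero (U : CfgY 𝔸 x.toKIdx) {q : IBondY x.toKIdx} {s : SiteY x.toKIdx} (ht : s ≠ repY x (utgt x q)) (hs : s ≠ repY x (usrc x q))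
    (a : 𝔸) : DbarTY x 𝔳 U (deltaY q a) s = 0 := by
  classical
  by_cases h : ∃ y, repY x y = s
  · obtain ⟨y, rfl⟩ := h
    rw [DbarTY_apply_repY, deltaY_eq_sglY]
    exact codT_sgl_eq_zero (RVTY x 𝔳 U) (usrc x) (utgt x) (fun e => ht (by rw [e])) (fun e => hs (by rw [e])) a
  · exact DbarTY_apply_of_not_range U _ h

/-- **KERNEL BOUND OF `D̄*`**: `‖D̄*(δ_q ⊗ a)(s)‖ ≤ w^D_{qs}‖a‖` — the same weights as `D̄`. [cite: Balaban1985BackgroundPropagators, (3.168) p.430, (3.185) p.432] -/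
theorem norm_DbarTY_deltaY_le {G : Subgroup 𝔸ˣ} (hG1 : ∀ g ∈ G, ‖((g : 𝔸ˣ) : 𝔸)‖ ≤ 1) {U : CfgY 𝔸 x.toKIdx} (h𝔳 : ∀ b, 𝔳 U b ∈ G)
    (q : IBondY x.toKIdx) (s : SiteY x.toKIdx) (a : 𝔸) : ‖DbarTY x 𝔳 U (deltaY q a) s‖ ≤ DbarWtY x q s * ‖a‖ := by
  classical
  by_cases h : ∃ y, repY x y = s
  · obtain ⟨y, rfl⟩ := h
    rw [DbarTY_apply_repY, deltaY_eq_sglY]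
    refine (norm_codT_sgl_le (RVTY x 𝔳 U) (norm_RVTY_le x hG1 h𝔳) (usrc x) (utgt x) q a y).trans (le_of_eq ?_)
    unfold DbarWtY
    congr 2
    · by_cases e : utgt x q = y
      · rw [if_pos e, if_pos (by rw [e])]
      · rw [if_neg e, if_neg (fun e' => e (repY_injective x e').symm)]
    · by_cases e : usrc x q = y
      · rw [if_pos e, if_pos (by rw [e])]
      · rw [if_neg e, if_neg (fun e' => e (repY_injective x e').symm)]
  · rw [DbarTY_apply_of_not_range U _ h, norm_zero]
    unfold DbarWtY
    positivity

variable [FiniteDimensional ℂ 𝔸]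

/-- **`m_{μ*} = 2(d+1)ℓ`**: the COLUMN masses of the blocks of `μ*`. [cite: Balaban1985BackgroundPropagators, (3.169) p.430, (3.185) p.432] -/
theorem colMass₂_muTY_le {G : Subgroup 𝔸ˣ} (hG1 : ∀ g ∈ G, ‖((g : 𝔸ˣ) : 𝔸)‖ ≤ 1) {U : CfgY 𝔸 x.toKIdx} (h𝔳 : ∀ b, 𝔳 U b ∈ G)
    (s : SiteY x.toKIdx) : ∑ p, ‖blockCLM₂ (muTY x 𝔳 U) p s‖ ≤ 2 * (((d + 1) * ℓ : ℕ) : ℝ) := by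
  classical
  refine (Finset.sum_le_sum fun p _ => ?_).trans (sum_muWtY_le (x := x) s)
  refine ContinuousLinearMap.opNorm_le_bound _ ?_ fun a => ?_
  · unfold muWtY; split
    · exact axOccY_nonneg _ _ _
    · exact le_rfl
  · rw [blockCLM₂_apply]; exact norm_muTY_deltaY_le hG1 h𝔳 s p a

/-- **`m_{D*} = 2`**: the COLUMN masses of the blocks of `D̄*`. [cite: Balaban1985BackgroundPropagators, (3.168) p.430, (3.185) p.432] -/
theorem colMass₂_DbarTY_le {G : Subgroup 𝔸ˣ} (hG1 : ∀ g ∈ G, ‖((g : 𝔸ˣ) : 𝔸)‖ ≤ 1) {U : CfgY 𝔸 x.toKIdx} (h𝔳 : ∀ b, 𝔳 U b ∈ G)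
    (q : IBondY x.toKIdx) : ∑ s, ‖blockCLM₂ (DbarTY x 𝔳 U) s q‖ ≤ 2 := by
  classical
  refine (Finset.sum_le_sum fun s _ => ?_).trans (sum_DbarWtY_le (x := x) q)
  refine ContinuousLinearMap.opNorm_le_bound _ ?_ fun a => ?_
  · unfold DbarWtY; positivity
  · rw [blockCLM₂_apply]; exact norm_DbarTY_deltaY_le hG1 h𝔳 q s a

/-- **`r_{μ*} = ℓ + 1`**: a non-zero block `(p, s)` of `μ*` has `s` a placed unit site `y` with `p` axial for the block of `y`. [cite: Balaban1985BackgroundPropagators, (3.169) p.430, (3.187) p.432, bookkeeping] -/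
theorem range₂_muTY_le (U : CfgY 𝔸 x.toKIdx) {p : IBondY x.toKIdx} {s : SiteY x.toKIdx} (h : blockCLM₂ (muTY x 𝔳 U) p s ≠ 0) :
    tdistK (ℓ := ℓ) (Mh := x.Mh) (k := x.k) (P := x.P') (kLab x p) (πSY x s) ≤ ℓ + 1 := by
  classical
  have hs : ∃ y, repY x y = s := by
    by_contra hne
    exact h (ContinuousLinearMap.ext fun a => by rw [blockCLM₂_apply, muTY_deltaY_eq_zero_of_not_range U hne]; rfl)
  obtain ⟨y, rfl⟩ := hs
  have hq : (axialFrameY x).InAx y p := by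
    by_contra hq
    exact h (ContinuousLinearMap.ext fun a => by rw [blockCLM₂_apply, muTY_deltaY_repY_eq_zero U hq]; rfl)
  obtain ⟨c, z, hy, hz, e⟩ := exists_block_of_inAx x hq
  rw [πSY_repY, tdistK_comm]
  have h1 : tdistK (ℓ := ℓ) (Mh := x.Mh) (k := x.k) (P := x.P') (labK x y) (labK x (usrc x p)) ≤ ℓ := by
    rw [e]; exact tdistK_labK_le_of_mem_block x hy hz
  have h2 := (tdistK_kLab_usrc_le x p).1
  rw [tdistK_comm] at h2
  linarith [tdistK_triangle (ℓ := ℓ) (Mh := x.Mh) (k := x.k) (P := x.P') (labK x y) (labK x (usrc x p)) (kLab x p)]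

/-- **`r_{D*} = 1`**: a non-zero block `(s, q)` of `D̄*` has `s` at the placed `b₊` or `b₋` of `q`. [cite: Balaban1985BackgroundPropagators, (3.168) p.430, (3.187) p.432, bookkeeping] -/
theorem range₂_DbarTY_le (U : CfgY 𝔸 x.toKIdx) {s : SiteY x.toKIdx} {q : IBondY x.toKIdx} (h : blockCLM₂ (DbarTY x 𝔳 U) s q ≠ 0) :
    tdistK (ℓ := ℓ) (Mh := x.Mh) (k := x.k) (P := x.P') (πSY x s) (kLab x q) ≤ 1 := by
  classical
  have hs : s = repY x (utgt x q) ∨ s = repY x (usrc x q) := by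
    by_contra hne
    rw [not_or] at hne
    exact h (ContinuousLinearMap.ext fun a => by rw [blockCLM₂_apply, DbarTY_deltaY_eq_zero U hne.1 hne.2]; rfl)
  rcases hs with rfl | rfl <;> rw [πSY_repY, tdistK_comm]
  · exact (tdistK_kLab_usrc_le x q).2
  · exact (tdistK_kLab_usrc_le x q).1

/-- ★★★ **`LocalOuterY` AT THE FOUR-LETTER RECORD, NO RESIDUAL HYPOTHESES**: for a norm-one structure group and `G`-valued `V`, n06-m's `LocalOuterY`
holds for `sectELettersYOfRecordT x 𝔳 𝔢₀` with `r = ℓ + 2`, `m_E = m_F = 1 + 4(d+1)ℓ`. [cite: Balaban1985BackgroundPropagators, (3.185) p.432, (3.168)–(3.169) p.430] -/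
theorem localOuterY_ofRecordT {G : Subgroup 𝔸ˣ} (hG1 : ∀ g ∈ G, ‖((g : 𝔸ˣ) : 𝔸)‖ ≤ 1) (𝔢₀ : SectELettersY 𝔸 x) {U : CfgY 𝔸 x.toKIdx}
    (h𝔳 : ∀ b, 𝔳 U b ∈ G) :
    LocalOuterY x (sectELettersYOfRecordT x 𝔳 𝔢₀) ((ℓ : ℝ) + 2) (1 + 4 * (((d + 1) * ℓ : ℕ) : ℝ)) (1 + 4 * (((d + 1) * ℓ : ℕ) : ℝ)) U := by
  have h := localOuterY_ofRecord hG1 { 𝔢₀ with muT := muTY x 𝔳, DbarT := DbarTY x 𝔳 } h𝔳 (rμT := (ℓ : ℝ) + 1) (rDT := 1)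
    (mμT := 2 * (((d + 1) * ℓ : ℕ) : ℝ)) (mDT := 2) (by positivity)
    (fun p s hps => range₂_muTY_le U hps) (colMass₂_muTY_le hG1 h𝔳) (fun s q hsq => range₂_DbarTY_le U hsq) (colMass₂_DbarTY_le hG1 h𝔳)
  have e1 : max 0 (max ((ℓ : ℝ) + 2) ((ℓ : ℝ) + 1 + 1)) = (ℓ : ℝ) + 2 := by
    rw [show (ℓ : ℝ) + 1 + 1 = (ℓ : ℝ) + 2 by ring, max_self, max_eq_right (by positivity)]
  have e2 : (1 : ℝ) + 2 * (((d + 1) * ℓ : ℕ) : ℝ) * 2 = 1 + 4 * (((d + 1) * ℓ : ℕ) : ℝ) := by ring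
  rw [e1, e2] at h
  exact h

end FacesT

/-! ## §6 Record level: the v5 instance of record — all four Sect. E letters genuine; row 24 with `LocalOuterY` discharged -/

section RecordV5

open scoped Matrix.Norms.L2Operator
open B7Prop2Explicit (unitaryUnits)
open B7Prop2SpecialUnitary (specialUnitaryUnits specialUnitaryUnits_le_unitaryUnits)
open B9PinMembersKLevelV1 (geo9Y bg9Y)
open B9PinGeometryKLevelV1 (c35Y inΛY unitDistY)
open B9Thm315WholeSectERep (DecayMidY t315_opsYOfRecordV4E_of_3185)
open B9Thm315WholeSectERepOn (DecayMidOnY t315_opsYOfRecordV4E_of_3185_on)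

/-- ★ **`hG1` AT THE RECORD FIBRE**: in `M_N(ℂ)` with the operator norm, every unit of a subgroup `G ≤ U(N)` has norm `≤ 1` (`= 1` for `N ≥ 1` by the
C⋆-identity; the fibre is trivial for `N = 0`) — the contraction hypothesis of `localOuterY_ofRecordT` for the transports `R(V(b)) = Ad V(b)`; cf. the tree's
`B10Eq26SiteGauge.norm_le_one_of_mem_unitary` (the same fact for `U ∈ unitary 𝔸`, not imported here to keep the import cone of NODE 00 small).
[cite: Balaban1985BackgroundPropagators, p.390 (|R(U)X| = |X|), (3.35) p.396, folklore] -/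
theorem norm_coe_le_one_of_le_unitaryUnits {N : ℕ} {G : Subgroup (Matrix (Fin N) (Fin N) ℂ)ˣ}
    (hG : G ≤ unitaryUnits (Matrix (Fin N) (Fin N) ℂ)) :
    ∀ g ∈ G, ‖((g : (Matrix (Fin N) (Fin N) ℂ)ˣ) : Matrix (Fin N) (Fin N) ℂ)‖ ≤ 1 := fun g hg => by
  rcases subsingleton_or_nontrivial (Matrix (Fin N) (Fin N) ℂ) with h | h
  · rw [Subsingleton.elim ((g : (Matrix (Fin N) (Fin N) ℂ)ˣ) : Matrix (Fin N) (Fin N) ℂ) 0, norm_zero]; exact zero_le_one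
  · exact (CStarRing.norm_of_mem_unitary (B7Prop2Explicit.mem_unitaryUnits.1 (hG hg))).le

/-- `hG1` for `G = SU(N)`. [cite: Balaban1985BackgroundPropagators, (3.35) p.396, folklore] -/
theorem norm_coe_le_one_specialUnitaryUnits {N : ℕ} :
    ∀ g ∈ specialUnitaryUnits (Fin N), ‖((g : (Matrix (Fin N) (Fin N) ℂ)ˣ) : Matrix (Fin N) (Fin N) ℂ)‖ ≤ 1 :=
  norm_coe_le_one_of_le_unitaryUnits specialUnitaryUnits_le_unitaryUnits

/-- ★ **TRACE ADJOINTNESS AT THE RECORD FIBRE**: `Σ_z Tr(μ(B)(z) f(z)) = Σ_q Tr(B(q) (μ*f)(q))` in `M_N(ℂ)`, every background, every units-valued `V`.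
[cite: Balaban1985BackgroundPropagators, (3.9) p.391, (3.185) p.432] -/
theorem sum_trace_muY_mul {N : ℕ} {x : MemberY d ℓ hd hL b₀ b₁ Mstar} {𝔳 : AvY (Matrix (Fin N) (Fin N) ℂ) x}
    (U : CfgY (Matrix (Fin N) (Fin N) ℂ) x.toKIdx) (B : IBondY x.toKIdx → Matrix (Fin N) (Fin N) ℂ) (f : SiteY x.toKIdx → Matrix (Fin N) (Fin N) ℂ) :
    ∑ z, Matrix.trace (muY x 𝔳 U B z * f z) = ∑ q, Matrix.trace (B q * muTY x 𝔳 U f q) :=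
  sum_tr_muY_mul (Matrix.traceLinearMap (Fin N) ℂ ℂ) (fun a b => Matrix.trace_mul_comm a b) U B f

/-- ★ `Σ_q Tr((D̄f)(q) A(q)) = Σ_z Tr(f(z) (D̄*A)(z))` in `M_N(ℂ)`. [cite: Balaban1985BackgroundPropagators, (3.9) p.391, (3.185) p.432] -/
theorem sum_trace_DbarY_mul {N : ℕ} {x : MemberY d ℓ hd hL b₀ b₁ Mstar} {𝔳 : AvY (Matrix (Fin N) (Fin N) ℂ) x}
    (U : CfgY (Matrix (Fin N) (Fin N) ℂ) x.toKIdx) (f : SiteY x.toKIdx → Matrix (Fin N) (Fin N) ℂ) (Al : IBondY x.toKIdx → Matrix (Fin N) (Fin N) ℂ) :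
    ∑ q, Matrix.trace (DbarY x 𝔳 U f q * Al q) = ∑ z, Matrix.trace (f z * DbarTY x 𝔳 U Al z) :=
  sum_tr_DbarY_mul (Matrix.traceLinearMap (Fin N) ℂ ℂ) (fun a b => Matrix.trace_mul_comm a b) U f Al

variable (N : ℕ) (θ : Stage3Params) (Mstar : ℕ)

/-- ★★ **THE v5 SECT. E LETTERS OF A STAGE 3′(Y) FAMILY**: member by member, `𝔢₀` with ALL FOUR letters `μ ∕ D̄ ∕ μ* ∕ D̄*` of (3.185) replaced by the
genuine `muY ∕ DbarY ∕ muTY ∕ DbarTY` over the averaged fields of record `V = avYOfRecord x U` (`Λ̃ ∕ C ∕ C* ∕ ⟨D̃⁽²⁾, J⟩ ∕ G̃₂` stay parameters).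
[cite: Balaban1985BackgroundPropagators, (3.168)–(3.169) p.430, (3.185) p.432] -/
def sectEYOfRecordV5 (𝔢₀ : SectEY N θ Mstar) : SectEY N θ Mstar := fun x => sectELettersYOfRecordT x (avYOfRecord x) (𝔢₀ x)

/-- ★★★ **THE v5 INSTANCE OF RECORD** of Stage 3′(Y): the v4 instance `opsYOfRecordV4E` (symmetrised transporters, genuine Sect. B∕D letters, `G(Ω′)`,
the (3.49) site reading, `C^{(k)}(Λ; U)` (3.156)–(3.158) with the (3.185) ∕ expansion slots) AT THE v5 SECT. E LETTERS.  Every `opsYOfRecordV4E_…` face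
applies verbatim (`opsYOfRecordV5E_eq`). [cite: Balaban1985BackgroundPropagators, Thms 3.1–3.15 pp.397–432, (3.168)–(3.169) p.430] -/
def opsYOfRecordV5E (𝔯 : ResY N θ Mstar) (𝔢₀ : SectEY N θ Mstar) (𝔴 : RWEY N θ Mstar) (𝔈 : ExpsY N θ Mstar) : OpsY N θ Mstar :=
  opsYOfRecordV4E N θ Mstar 𝔯 (sectEYOfRecordV5 N θ Mstar 𝔢₀) 𝔴 𝔈

variable (𝔯 : ResY N θ Mstar) (𝔢₀ : SectEY N θ Mstar) (𝔴 : RWEY N θ Mstar) (𝔈 : ExpsY N θ Mstar)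

/-- the v5 instance is the v4 instance at the v5 Sect. E letters. [cite: Balaban1985BackgroundPropagators, (3.169) p.430, bookkeeping] -/
theorem opsYOfRecordV5E_eq : opsYOfRecordV5E N θ Mstar 𝔯 𝔢₀ 𝔴 𝔈 = opsYOfRecordV4E N θ Mstar 𝔯 (sectEYOfRecordV5 N θ Mstar 𝔢₀) 𝔴 𝔈 := rfl

/-- the v5 Sect. E letters at a member. [cite: Balaban1985BackgroundPropagators, (3.168)–(3.169) p.430, bookkeeping] -/
theorem sectEYOfRecordV5_apply (x : MemberY θ.d₆ θ.ℓ₆ θ.hd' θ.hL' θ.b₀ θ.b₁ Mstar) :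
    sectEYOfRecordV5 N θ Mstar 𝔢₀ x = sectELettersYOfRecordT x (avYOfRecord x) (𝔢₀ x) := rfl

/-- the v5 letters are `Node00.OpsYSectELetters`' record of the averaged fields of record applied to `𝔢₀` with its right letters replaced — every face of
`sectEYOfRecord` applies. [cite: Balaban1985BackgroundPropagators, (3.185) p.432, bookkeeping] -/
theorem sectEYOfRecordV5_eq_sectEYOfRecord : sectEYOfRecordV5 N θ Mstar 𝔢₀ =
    sectEYOfRecord N θ Mstar (avEYOfRecord N θ Mstar) (fun x => { 𝔢₀ x with muT := muTY x (avYOfRecord x), DbarT := DbarTY x (avYOfRecord x) }) := rfl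

/-- the v5 record's four genuine letters at a member. [cite: Balaban1985BackgroundPropagators, (3.168)–(3.169) p.430, (3.185) p.432, bookkeeping] -/
theorem sectEYOfRecordV5_letters (x : MemberY θ.d₆ θ.ℓ₆ θ.hd' θ.hL' θ.b₀ θ.b₁ Mstar) :
    (sectEYOfRecordV5 N θ Mstar 𝔢₀ x).mu = muY x (avYOfRecord x) ∧ (sectEYOfRecordV5 N θ Mstar 𝔢₀ x).Dbar = DbarY x (avYOfRecord x) ∧
      (sectEYOfRecordV5 N θ Mstar 𝔢₀ x).muT = muTY x (avYOfRecord x) ∧ (sectEYOfRecordV5 N θ Mstar 𝔢₀ x).DbarT = DbarTY x (avYOfRecord x) :=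
  ⟨rfl, rfl, rfl, rfl⟩

/-- the v5 record keeps `𝔢₀`'s `Λ̃`, `C`, `C*`, `⟨D̃⁽²⁾, J⟩`, `G̃₂`. [cite: Balaban1985BackgroundPropagators, (3.156)–(3.157) p.428, (3.186) p.432, bookkeeping] -/
theorem sectEYOfRecordV5_params (x : MemberY θ.d₆ θ.ℓ₆ θ.hd' θ.hL' θ.b₀ θ.b₁ Mstar) :
    (sectEYOfRecordV5 N θ Mstar 𝔢₀ x).LamT = (𝔢₀ x).LamT ∧ (sectEYOfRecordV5 N θ Mstar 𝔢₀ x).elimC = (𝔢₀ x).elimC ∧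
      (sectEYOfRecordV5 N θ Mstar 𝔢₀ x).elimCt = (𝔢₀ x).elimCt ∧ (sectEYOfRecordV5 N θ Mstar 𝔢₀ x).D2J = (𝔢₀ x).D2J ∧
      (sectEYOfRecordV5 N θ Mstar 𝔢₀ x).Gt2 = (𝔢₀ x).Gt2 :=
  ⟨rfl, rfl, rfl, rfl, rfl⟩

/-- the v5 instance's base letters, exponents, `P349` and expansion slot are the v4 instance's (same `𝔯`, `𝔴`, `𝔈`).
[cite: Balaban1985BackgroundPropagators, Thms 3.1–3.14 pp.397–427, bookkeeping] -/
theorem opsYOfRecordV5E_letters (x : MemberY θ.d₆ θ.ℓ₆ θ.hd' θ.hL' θ.b₀ θ.b₁ Mstar) :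
    (opsYOfRecordV5E N θ Mstar 𝔯 𝔢₀ 𝔴 𝔈 x).P349 = (opsYOfRecordV4E N θ Mstar 𝔯 𝔢₀ 𝔴 𝔈 x).P349 ∧
      (opsYOfRecordV5E N θ Mstar 𝔯 𝔢₀ 𝔴 𝔈 x).HasRWExpC = (opsYOfRecordV4E N θ Mstar 𝔯 𝔢₀ 𝔴 𝔈 x).HasRWExpC :=
  ⟨rfl, rfl⟩

/-- ★★★ **`LocalOuterY` AT THE v5 RECORD — NO RESIDUAL HYPOTHESIS**: at a member, for a `G`-valued background with `G ≤ U(N)`, n06-m's locality schema of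
BOTH outer factors `P_Λ(1 + D̄μ)P_Λ`, `P_Λ(1 + μ*D̄*)P_Λ` of (3.185) holds with `r = ℓ + 2`, `m_E = m_F = 1 + 4(d+1)ℓ`.
[cite: Balaban1985BackgroundPropagators, (3.185) p.432, (3.168)–(3.169) p.430] -/
theorem localOuterY_sectEYOfRecordV5 (x : MemberY θ.d₆ θ.ℓ₆ θ.hd' θ.hL' θ.b₀ θ.b₁ Mstar)
    {G : Subgroup (Matrix (Fin N) (Fin N) ℂ)ˣ} (hG : G ≤ unitaryUnits (Matrix (Fin N) (Fin N) ℂ))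
    {U : CfgY (Matrix (Fin N) (Fin N) ℂ) x.toKIdx} (hU : ∀ μ z, U μ z ∈ G) :
    LocalOuterY x (sectEYOfRecordV5 N θ Mstar 𝔢₀ x) ((θ.ℓ₆ : ℝ) + 2) (1 + 4 * (((θ.d₆ + 1) * θ.ℓ₆ : ℕ) : ℝ))
      (1 + 4 * (((θ.d₆ + 1) * θ.ℓ₆ : ℕ) : ℝ)) U :=
  localOuterY_ofRecordT (norm_coe_le_one_of_le_unitaryUnits hG) (𝔢₀ x) (fun b => avYOfRecord_mem x hU b)

/-- the v5 record's `μ ∕ μ*` are trace-transposes of each other. [cite: Balaban1985BackgroundPropagators, (3.9) p.391, (3.185) p.432] -/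
theorem sum_trace_mu_muT_sectEYOfRecordV5 (x : MemberY θ.d₆ θ.ℓ₆ θ.hd' θ.hL' θ.b₀ θ.b₁ Mstar) (U : CfgY (Matrix (Fin N) (Fin N) ℂ) x.toKIdx)
    (B : IBondY x.toKIdx → Matrix (Fin N) (Fin N) ℂ) (f : SiteY x.toKIdx → Matrix (Fin N) (Fin N) ℂ) :
    ∑ z, Matrix.trace ((sectEYOfRecordV5 N θ Mstar 𝔢₀ x).mu U B z * f z) = ∑ q, Matrix.trace (B q * (sectEYOfRecordV5 N θ Mstar 𝔢₀ x).muT U f q) :=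
  sum_trace_muY_mul U B f

/-- the v5 record's `D̄ ∕ D̄*` are trace-transposes of each other. [cite: Balaban1985BackgroundPropagators, (3.9) p.391, (3.185) p.432] -/
theorem sum_trace_Dbar_DbarT_sectEYOfRecordV5 (x : MemberY θ.d₆ θ.ℓ₆ θ.hd' θ.hL' θ.b₀ θ.b₁ Mstar) (U : CfgY (Matrix (Fin N) (Fin N) ℂ) x.toKIdx)
    (f : SiteY x.toKIdx → Matrix (Fin N) (Fin N) ℂ) (Al : IBondY x.toKIdx → Matrix (Fin N) (Fin N) ℂ) :
    ∑ q, Matrix.trace ((sectEYOfRecordV5 N θ Mstar 𝔢₀ x).Dbar U f q * Al q) = ∑ z, Matrix.trace (f z * (sectEYOfRecordV5 N θ Mstar 𝔢₀ x).DbarT U Al z) :=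
  sum_trace_DbarY_mul U f Al

/-- ★★★ **ROW 24 (`t315`) AT THE v5 INSTANCE OF RECORD THROUGH THE (3.185) SLOT — THREE DISPLAYED CONJUNCTS**: under the printed prefix, displayed are the
(3.185) identity at the v5 letters, the expansion slot (3.186) and the middle-factor decay; the locality schema `LocalOuterY` of both outer factors
`P_Λ(1 + D̄μ)P_Λ`, `P_Λ(1 + μ*D̄*)P_Λ` is PROVED (`G = SU(N) ≤ U(N)`, `U` `G`-valued by the (3.35) clause).
[cite: Balaban1985BackgroundPropagators, Thm 3.15 (3.185)–(3.187) p.432, (3.168)–(3.169) p.430, (3.186) p.432] -/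
theorem t315_opsYOfRecordV5E_of_3185 {a₀ δ₁ B₁ : ℝ} (ha₀ : 0 < a₀) (hδ₁ : 0 < δ₁) (hB₁ : 0 < B₁)
    (h : ∀ (x : MemberY θ.d₆ θ.ℓ₆ θ.hd' θ.hL' θ.b₀ θ.b₁ Mstar) (α₀ : ℝ), 0 < α₀ → (geo9Y x).M * α₀ ≤ a₀ →
      ∀ U : (bg9Y (Matrix (Fin N) (Fin N) ℂ) (specialUnitaryUnits (Fin N)) x).Cfg,
        (bg9Y (Matrix (Fin N) (Fin N) ℂ) (specialUnitaryUnits (Fin N)) x).Reg335 c35Y α₀ U →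
        (bg9Y (Matrix (Fin N) (Fin N) ℂ) (specialUnitaryUnits (Fin N)) x).Reg336 c35Y α₀ U →
          givenBy3185Y x (lettersYOfRecordV4 N θ Mstar 𝔯 x) (sectEYOfRecordV5 N θ Mstar 𝔢₀ x) U ∧ hasRWExpCY (𝔴 x) U δ₁ ∧
            DecayMidY x (lettersYOfRecordV4 N θ Mstar 𝔯 x) (sectEYOfRecordV5 N θ Mstar 𝔢₀ x) B₁ U δ₁) :
    B9.Thm315FullPrinted c35Y geo9Y (bg9Y (Matrix (Fin N) (Fin N) ℂ) (specialUnitaryUnits (Fin N)))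
      (fun x => (opsYOfRecordV5E N θ Mstar 𝔯 𝔢₀ 𝔴 𝔈 x).Ck) inΛY unitDistY
      (fun x => (opsYOfRecordV5E N θ Mstar 𝔯 𝔢₀ 𝔴 𝔈 x).GivenBy3185) (fun x => (opsYOfRecordV5E N θ Mstar 𝔯 𝔢₀ 𝔴 𝔈 x).HasRWExpC) := by
  have hmE : (0 : ℝ) < 1 + 4 * (((θ.d₆ + 1) * θ.ℓ₆ : ℕ) : ℝ) := by positivity
  refine t315_opsYOfRecordV4E_of_3185 N θ Mstar 𝔯 (sectEYOfRecordV5 N θ Mstar 𝔢₀) 𝔴 𝔈 (r := (θ.ℓ₆ : ℝ) + 2) ha₀ hδ₁ hB₁ hmE hmE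
    fun x α₀ hα hMa U hU hU' => ?_
  obtain ⟨h85, hRW, hS⟩ := h x α₀ hα hMa U hU hU'
  exact ⟨h85, hRW, localOuterY_sectEYOfRecordV5 N θ Mstar 𝔢₀ x specialUnitaryUnits_le_unitaryUnits hU.1.1, hS⟩

/-- ★★★ **THE SAME ON `B9Thm315WholeSectERepOn`** (middle decay asked between Λ-bonds only — the tightest (3.185)-slot face): displayed are the (3.185)
identity, the expansion slot and `DecayMidOnY`; both outer factors' locality is PROVED.
[cite: Balaban1985BackgroundPropagators, Thm 3.15 (3.185)–(3.187) p.432, (3.168)–(3.169) p.430, (3.186) p.432] -/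
theorem t315_opsYOfRecordV5E_of_3185_on {a₀ δ₁ B₁ : ℝ} (ha₀ : 0 < a₀) (hδ₁ : 0 < δ₁) (hB₁ : 0 < B₁)
    (h : ∀ (x : MemberY θ.d₆ θ.ℓ₆ θ.hd' θ.hL' θ.b₀ θ.b₁ Mstar) (α₀ : ℝ), 0 < α₀ → (geo9Y x).M * α₀ ≤ a₀ →
      ∀ U : (bg9Y (Matrix (Fin N) (Fin N) ℂ) (specialUnitaryUnits (Fin N)) x).Cfg,
        (bg9Y (Matrix (Fin N) (Fin N) ℂ) (specialUnitaryUnits (Fin N)) x).Reg335 c35Y α₀ U →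
        (bg9Y (Matrix (Fin N) (Fin N) ℂ) (specialUnitaryUnits (Fin N)) x).Reg336 c35Y α₀ U →
          givenBy3185Y x (lettersYOfRecordV4 N θ Mstar 𝔯 x) (sectEYOfRecordV5 N θ Mstar 𝔢₀ x) U ∧ hasRWExpCY (𝔴 x) U δ₁ ∧
            DecayMidOnY x (lettersYOfRecordV4 N θ Mstar 𝔯 x) (sectEYOfRecordV5 N θ Mstar 𝔢₀ x) B₁ U δ₁) :
    B9.Thm315FullPrinted c35Y geo9Y (bg9Y (Matrix (Fin N) (Fin N) ℂ) (specialUnitaryUnits (Fin N)))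
      (fun x => (opsYOfRecordV5E N θ Mstar 𝔯 𝔢₀ 𝔴 𝔈 x).Ck) inΛY unitDistY
      (fun x => (opsYOfRecordV5E N θ Mstar 𝔯 𝔢₀ 𝔴 𝔈 x).GivenBy3185) (fun x => (opsYOfRecordV5E N θ Mstar 𝔯 𝔢₀ 𝔴 𝔈 x).HasRWExpC) := by
  have hmE : (0 : ℝ) < 1 + 4 * (((θ.d₆ + 1) * θ.ℓ₆ : ℕ) : ℝ) := by positivity
  refine t315_opsYOfRecordV4E_of_3185_on N θ Mstar 𝔯 (sectEYOfRecordV5 N θ Mstar 𝔢₀) 𝔴 𝔈 (r := (θ.ℓ₆ : ℝ) + 2) ha₀ hδ₁ hB₁ hmE hmE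
    fun x α₀ hα hMa U hU hU' => ?_
  obtain ⟨h85, hRW, hS⟩ := h x α₀ hα hMa U hU hU'
  exact ⟨h85, hRW, localOuterY_sectEYOfRecordV5 N θ Mstar 𝔢₀ x specialUnitaryUnits_le_unitaryUnits hU.1.1, hS⟩

end RecordV5

end Literature.MathematicalPhysics.QuantumFieldTheory.Balaban1983to89.Node00

end
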